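import Summits.ABC.ABC.Theses.IsogenyGlueCongruence
import Summits.ABC.ABC.Theorems.IsogenyGlueCongruenceEllipticGluingPrimeBoundStubMinkowski
import Summits.ABC.ABC.Theorems.IsogenyGlueCongruenceEllipticGluingPrimeBoundStubCaseB
import Summits.ABC.ABC.Theorems.IsogenyGlueCongruenceEllipticGluingPrimeBoundStubIsotypicDichotomy
import Summits.ABC.ABC.Theorems.IsogenyGlueCongruenceEllipticGluingPrimeBoundStubGeomIsotypicSplitting
import Summits.ABC.ABC.Theorems.IsogenyGlueCongruenceEllipticGluingPrimeBoundStubIsotypicBranchPolyOf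
import Summits.ABC.ABC.Theorems.IsogenyGlueCongruenceEllipticGluingPrimeBoundStubRationalPartReduction
import Summits.ABC.ABC.Theorems.IsogenyGlueCongruenceEllipticGluingPrimeBoundStubBigImageTorsionCore
import Summits.ABC.ABC.Theorems.IsogenyGlueCongruenceEllipticGluingPrimeBoundStubCMTorsionCoreOf
import Summits.ABC.ABC.Theorems.IsogenyGlueCongruenceEllipticGluingPrimeBoundStubCMIsotypicCoreOf
import Summits.ABC.ABC.Theorems.EllipticGluingPrimeBound.Negative.LoadBearing
import Literature.NumberTheory.EllipticCurves.OpenImage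
import Literature.NumberTheory.EllipticCurves.MasserWustholzSurjectivity
import Literature.NumberTheory.EllipticCurves.CMTorsionGaloisImage
import HarnessLib

/-!
# Crux U `EllipticGluingPrimeBound` (stmt-ABC-13919): the REDUCTION THEOREM of line `Sketch`

`EllipticGluingPrimeBound` follows from (a) the height-free torsion-sharing bound with GEOMETRICALLY
`E`-FREE partners (`U_free`, the line's registered stub `stub_geomFreeTorsionBound` — an open problem
of Frey–Mazur type, taken here as the hypothesis `hFree`) and (b) four published theorems present in
the tree as named facts: Mazur 1978 (`mazur_isogeny_irreducible`), Masser–Wüstholz 1993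
(`masserWustholz_surjective_modEll`), the main theorem of complex multiplication on `ℓ`-torsion
(`cmTorsion_cartanImage`) and Faltings 1983 (`faltings_tate_bijective`, for abelian varieties over
`ℚ`).  Everything else of the isotypic–Minkowski reduction is PROVED in the tree and imported here:
the geometrically-isotypic splitting over `ℚ`, the Case-B engine and the dichotomy
(`stub_geomIsotypicSplitting`, `stub_caseB`, `stub_isotypicDichotomy`), the rational-part reduction,
the big-image and CM torsion cores, Minkowski's bound and the two compositions of the isotypic branch
(`stub_rationalPartReduction`, `stub_bigImageTorsionCore`, `stub_CMTorsionCoreOf`,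
`stub_CMIsotypicCoreOf`, `stub_minkowski`, `stub_isotypicBranchPolyOf`).

* `bound_of_branches` — the real-analysis bookkeeping: dichotomy + polynomial isotypic bound + free
  bound ⟹ the body of the crux (`κ' = max 1 (max γ κ)`, `C' = max L₀ L₁ + max c 0 + max C 0`).
* `ellipticGluingPrimeBound_of_free` — the reduction theorem: the four facts and `U_free` imply
  `EllipticGluingPrimeBound` (conditional result; it does not close the item, whose residual is
  exactly `U_free`).

Lands `--supports stmt-ABC-13919`.  No new definitions; no `sorry`.
-/

noncomputable section

-- `Summit.<Summit>.<Problem>` is the mandated summit-side namespace (CONVENTIONS §2); for the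
-- single-conjunct summit `ABC` the two coincide, so the duplicate `ABC.ABC` is deliberate.
set_option linter.dupNamespace false

namespace Summit.ABC.ABC.Theorems.IsotypicMinkowski

open CategoryTheory CategoryTheory.Limits AlgebraicGeometry
open Literature.AlgebraicGeometry.Motives
open Summit.ABC.ABC.Theses.IsogenyGlueCongruence

/-- **Composition of the line (v2).** Dichotomy + polynomial isotypic-branch bound + free-branch
bound give the body of the crux (stated unfolded, so that exactly one theorem of the file
concludes the crux by name), with `κ' = max 1 (max γ κ)` and `C' = max L₀ L₁ + max c 0 + max C 0`:
in a glued instance the base `X = dim B · max 1 h_F(W)` is `≥ 1`; primes `ℓ ≤ max L₀ L₁` are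
absorbed by the constant; beyond, the isotypic case gives `ℓ ≤ c (dim B₁ · max 1 h)^γ ≤ max c 0 · X^κ'`
(`dim B₁ ≤ dim B`) and the free case `ℓ ≤ C ((dim A + 1) max 1 h)^κ ≤ max C 0 · X^κ'`
(`dim A + 1 ≤ dim B`). The three hypotheses are the conclusions of `stub_isotypicDichotomy`,
`stub_isotypicBranchPoly`, `stub_geomFreeTorsionBound` (binder-for-binder). -/
theorem bound_of_branches
    (hD : ∃ L₀ : ℕ, ∀ (W : WeierstrassCurve ℚ) [W.IsElliptic] (E B : AbelianVariety.{0} ℚ)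
      (e : E.geomPoints ≃+ W.geomPoints),
      (∀ (σ : Field.absoluteGaloisGroup ℚ) (P : E.geomPoints), e (σ • P) = σ • e P) →
      ∀ ℓ : ℕ, ℓ.Prime → L₀ < ℓ →
      (∃ (α : E ⟶ B) (β : B ⟶ E) (n : ℤ), n ≠ 0 ∧ α ≫ β = n • 𝟙 E) →
      (∀ (α : E ⟶ B) (β : B ⟶ E) (n : ℤ), α ≫ β = n • 𝟙 E → (ℓ : ℤ) ∣ n) →
      (∃ B₁ : AbelianVariety.{0} ℚ, B₁.dim ≤ B.dim ∧
        (∀ (C : AbelianVariety.{0} (AlgebraicClosure ℚ))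
            (g : B₁.baseChange (AlgebraicClosure ℚ) ⟶ C),
            Surjective (AbelianVariety.Hom.toSchemeHom g) → C.dim ≠ 0 →
            ∃ f : E.baseChange (AlgebraicClosure ℚ) ⟶ C, f ≠ 0) ∧
        (∃ (α : E ⟶ B₁) (β : B₁ ⟶ E) (n : ℤ), n ≠ 0 ∧ α ≫ β = n • 𝟙 E) ∧
        (∀ (α : E ⟶ B₁) (β : B₁ ⟶ E) (n : ℤ), α ≫ β = n • 𝟙 E → (ℓ : ℤ) ∣ n)) ∨
      (∃ A : AbelianVariety.{0} ℚ, A.dim + 1 ≤ B.dim ∧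
        (∀ f : E.baseChange (AlgebraicClosure ℚ) ⟶ A.baseChange (AlgebraicClosure ℚ), f = 0) ∧
        ∃ ι : W.geomTorsion ℓ →+ A.geomPoints, Function.Injective ι ∧
          ∀ (σ : Field.absoluteGaloisGroup ℚ) (P : W.geomTorsion ℓ), ι (σ • P) = σ • ι P))
    (hI : ∃ (L₀ : ℕ) (γ c : ℝ), 0 ≤ γ ∧ ∀ (W : WeierstrassCurve ℚ) [W.IsElliptic]
      (E B : AbelianVariety.{0} ℚ) (e : E.geomPoints ≃+ W.geomPoints),
      (∀ (σ : Field.absoluteGaloisGroup ℚ) (P : E.geomPoints), e (σ • P) = σ • e P) →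
      (∀ (C : AbelianVariety.{0} (AlgebraicClosure ℚ))
          (g : B.baseChange (AlgebraicClosure ℚ) ⟶ C),
          Surjective (AbelianVariety.Hom.toSchemeHom g) → C.dim ≠ 0 →
          ∃ f : E.baseChange (AlgebraicClosure ℚ) ⟶ C, f ≠ 0) →
      ∀ ℓ : ℕ, ℓ.Prime → L₀ < ℓ →
      (∃ (α : E ⟶ B) (β : B ⟶ E) (n : ℤ), n ≠ 0 ∧ α ≫ β = n • 𝟙 E) →
      (∀ (α : E ⟶ B) (β : B ⟶ E) (n : ℤ), α ≫ β = n • 𝟙 E → (ℓ : ℤ) ∣ n) →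
        (ℓ : ℝ) ≤ c * ((B.dim : ℝ) * max 1 W.stableFaltingsHeight) ^ γ)
    (hF : ∃ κ C : ℝ, 0 ≤ κ ∧ ∀ (W : WeierstrassCurve ℚ) [W.IsElliptic] (E A : AbelianVariety.{0} ℚ)
      (e : E.geomPoints ≃+ W.geomPoints),
      (∀ (σ : Field.absoluteGaloisGroup ℚ) (P : E.geomPoints), e (σ • P) = σ • e P) →
      (∀ f : E.baseChange (AlgebraicClosure ℚ) ⟶ A.baseChange (AlgebraicClosure ℚ), f = 0) →
      ∀ ℓ : ℕ, ℓ.Prime →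
      (∃ ι : W.geomTorsion ℓ →+ A.geomPoints, Function.Injective ι ∧
        ∀ (σ : Field.absoluteGaloisGroup ℚ) (P : W.geomTorsion ℓ), ι (σ • P) = σ • ι P) →
        (ℓ : ℝ) ≤ C * (((A.dim : ℝ) + 1) * max 1 W.stableFaltingsHeight) ^ κ) :
    ∃ κ C : ℝ, 0 ≤ κ ∧ ∀ (W : WeierstrassCurve ℚ) [W.IsElliptic] (E B : AbelianVariety.{0} ℚ)
      (e : E.geomPoints ≃+ W.geomPoints),
      (∀ (σ : Field.absoluteGaloisGroup ℚ) (P : E.geomPoints), e (σ • P) = σ • e P) →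
      ∀ ℓ : ℕ, ℓ.Prime →
        (∃ (α : E ⟶ B) (β : B ⟶ E) (n : ℤ), n ≠ 0 ∧ α ≫ β = n • 𝟙 E) →
        (∀ (α : E ⟶ B) (β : B ⟶ E) (n : ℤ), α ≫ β = n • 𝟙 E → (ℓ : ℤ) ∣ n) →
          (ℓ : ℝ) ≤ C * ((B.dim : ℝ) * max 1 W.stableFaltingsHeight) ^ κ := by
  obtain ⟨L₀, hD⟩ := hD
  obtain ⟨L₁, γ, c, hγ, hI⟩ := hI
  obtain ⟨κ, C, hκ, hF⟩ := hF
  refine ⟨max 1 (max γ κ), ((max L₀ L₁ : ℕ) : ℝ) + max c 0 + max C 0,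
    zero_le_one.trans (le_max_left _ _), ?_⟩
  intro W _ E B e he ℓ hℓ hex hall
  set κ' : ℝ := max 1 (max γ κ) with hκ'
  set C' : ℝ := ((max L₀ L₁ : ℕ) : ℝ) + max c 0 + max C 0 with hC'
  set X : ℝ := (B.dim : ℝ) * max 1 W.stableFaltingsHeight with hX
  have hdim : (1 : ℝ) ≤ B.dim := by
    exact_mod_cast Nat.one_le_iff_ne_zero.2
      (EllipticGluingPrimeBound.Negative.dim_ne_zero_of_multiplier e hex)
  have hh : (1 : ℝ) ≤ max 1 W.stableFaltingsHeight := le_max_left _ _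
  have hm0 : (0 : ℝ) ≤ max 1 W.stableFaltingsHeight := zero_le_one.trans hh
  have hX1 : 1 ≤ X := by rw [hX]; nlinarith
  have hκ'1 : 1 ≤ κ' := le_max_left _ _
  have hκ'0 : 0 ≤ κ' := zero_le_one.trans hκ'1
  have hXpow1 : 1 ≤ X ^ κ' := Real.one_le_rpow hX1 hκ'0
  have hXpow0 : 0 ≤ X ^ κ' := zero_le_one.trans hXpow1
  have hM0 : (0 : ℝ) ≤ ((max L₀ L₁ : ℕ) : ℝ) := Nat.cast_nonneg _
  have hc0 : (0 : ℝ) ≤ max c 0 := le_max_right _ _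
  have hC0 : (0 : ℝ) ≤ max C 0 := le_max_right _ _
  have key : ∀ K : ℝ, K ≤ C' → (ℓ : ℝ) ≤ K * X ^ κ' → (ℓ : ℝ) ≤ C' * X ^ κ' :=
    fun K hK h ↦ h.trans (mul_le_mul_of_nonneg_right hK hXpow0)
  by_cases hsmall : ℓ ≤ max L₀ L₁
  · refine key ((max L₀ L₁ : ℕ) : ℝ) (by rw [hC']; linarith) ?_
    calc (ℓ : ℝ) ≤ ((max L₀ L₁ : ℕ) : ℝ) := by exact_mod_cast hsmall
      _ = ((max L₀ L₁ : ℕ) : ℝ) * 1 := (mul_one _).symm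
      _ ≤ ((max L₀ L₁ : ℕ) : ℝ) * X ^ κ' := mul_le_mul_of_nonneg_left hXpow1 hM0
  · push Not at hsmall
    have hL₀ : L₀ < ℓ := lt_of_le_of_lt (le_max_left _ _) hsmall
    have hL₁ : L₁ < ℓ := lt_of_le_of_lt (le_max_right _ _) hsmall
    rcases hD W E B e he ℓ hℓ hL₀ hex hall with
      ⟨B₁, hB₁, hiso, hex₁, hall₁⟩ | ⟨A, hA, hfree, hemb⟩
    · refine key (max c 0) (by rw [hC']; linarith) ?_
      have hI1 := hI W E B₁ e he hiso ℓ hℓ hL₁ hex₁ hall₁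
      have hB₁' : (B₁.dim : ℝ) ≤ B.dim := by exact_mod_cast hB₁
      have hY0 : (0 : ℝ) ≤ (B₁.dim : ℝ) * max 1 W.stableFaltingsHeight :=
        mul_nonneg (Nat.cast_nonneg _) hm0
      have hYX : (B₁.dim : ℝ) * max 1 W.stableFaltingsHeight ≤ X := by
        rw [hX]; exact mul_le_mul_of_nonneg_right hB₁' hm0
      calc (ℓ : ℝ) ≤ c * ((B₁.dim : ℝ) * max 1 W.stableFaltingsHeight) ^ γ := hI1
        _ ≤ max c 0 * ((B₁.dim : ℝ) * max 1 W.stableFaltingsHeight) ^ γ :=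
            mul_le_mul_of_nonneg_right (le_max_left _ _) (Real.rpow_nonneg hY0 γ)
        _ ≤ max c 0 * X ^ γ := mul_le_mul_of_nonneg_left (Real.rpow_le_rpow hY0 hYX hγ) hc0
        _ ≤ max c 0 * X ^ κ' :=
            mul_le_mul_of_nonneg_left (Real.rpow_le_rpow_of_exponent_le hX1
              ((le_max_left _ _).trans (le_max_right _ _))) hc0
    · refine key (max C 0) (by rw [hC']; linarith) ?_
      have hF1 := hF W E A e he hfree ℓ hℓ hemb
      have hA' : (A.dim : ℝ) + 1 ≤ B.dim := by exact_mod_cast hA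
      have hY0 : (0 : ℝ) ≤ ((A.dim : ℝ) + 1) * max 1 W.stableFaltingsHeight :=
        mul_nonneg (by positivity) hm0
      have hYX : ((A.dim : ℝ) + 1) * max 1 W.stableFaltingsHeight ≤ X := by
        rw [hX]; exact mul_le_mul_of_nonneg_right hA' hm0
      calc (ℓ : ℝ) ≤ C * (((A.dim : ℝ) + 1) * max 1 W.stableFaltingsHeight) ^ κ := hF1
        _ ≤ max C 0 * (((A.dim : ℝ) + 1) * max 1 W.stableFaltingsHeight) ^ κ :=
            mul_le_mul_of_nonneg_right (le_max_left _ _) (Real.rpow_nonneg hY0 κ)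
        _ ≤ max C 0 * X ^ κ := mul_le_mul_of_nonneg_left (Real.rpow_le_rpow hY0 hYX hκ) hC0
        _ ≤ max C 0 * X ^ κ' :=
            mul_le_mul_of_nonneg_left (Real.rpow_le_rpow_of_exponent_le hX1
              ((le_max_right _ _).trans (le_max_right _ _))) hC0

/-- **Reduction theorem of line `Sketch` for crux U.** Mazur's theorem, the Masser–Wüstholz
surjectivity theorem, the CM torsion fact, Faltings' theorem for `Hom` over `ℚ` (the four named
facts, hypotheses) and the height-free torsion-sharing bound with geometrically `E`-free partners
(`U_free`, hypothesis `hFree` — OPEN) together imply `EllipticGluingPrimeBound`: feed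
`bound_of_branches` with the landed dichotomy (Mazur + splitting + Case-B engine), the landed
isotypic branch (Minkowski + Masser–Wüstholz + rational-part reduction + big-image core + CM core
from the CM fact, the CM torsion core and Faltings) and `hFree`. Conditional result: the crux is
thereby reduced to `U_free`. -/
theorem ellipticGluingPrimeBound_of_free
    (hMazur : Literature.NumberTheory.EllipticCurves.mazur_isogeny_irreducible)
    (hMW : Literature.NumberTheory.EllipticCurves.masserWustholz_surjective_modEll)
    (hCM : Literature.NumberTheory.EllipticCurves.cmTorsion_cartanImage)
    (hFal : ∀ (A B : AbelianVariety.{0} ℚ) (ℓ : ℕ) [Fact ℓ.Prime],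
      Literature.AlgebraicGeometry.Motives.faltings_tate_bijective A B ℓ)
    (hFree : ∃ κ C : ℝ, 0 ≤ κ ∧ ∀ (W : WeierstrassCurve ℚ) [W.IsElliptic]
      (E A : AbelianVariety.{0} ℚ) (e : E.geomPoints ≃+ W.geomPoints),
      (∀ (σ : Field.absoluteGaloisGroup ℚ) (P : E.geomPoints), e (σ • P) = σ • e P) →
      (∀ f : E.baseChange (AlgebraicClosure ℚ) ⟶ A.baseChange (AlgebraicClosure ℚ), f = 0) →
      ∀ ℓ : ℕ, ℓ.Prime →
      (∃ ι : W.geomTorsion ℓ →+ A.geomPoints, Function.Injective ι ∧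
        ∀ (σ : Field.absoluteGaloisGroup ℚ) (P : W.geomTorsion ℓ), ι (σ • P) = σ • ι P) →
        (ℓ : ℝ) ≤ C * (((A.dim : ℝ) + 1) * max 1 W.stableFaltingsHeight) ^ κ) :
    EllipticGluingPrimeBound :=
  bound_of_branches
    (stub_isotypicDichotomy hMazur stub_geomIsotypicSplitting
      (fun W _ E B B₁ B₂ e he ℓ hℓ hirr hall i j hi hσ α₀ β₀ m hm hndvd ↦ by
        haveI := hi
        exact stub_caseB e he hℓ hirr hall i j hσ α₀ β₀ m hm hndvd))
    (stub_isotypicBranchPolyOf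
      (fun r ℓ hℓ G hG h ↦ by haveI := hG; exact stub_minkowski r ℓ hℓ G h)
      (by exact hMW)
      (fun _ _ _ _ e he hiso _ hℓ hirr hsc hex hall ↦
        stub_rationalPartReduction e he hiso hℓ hirr hsc hex hall)
      stub_bigImageTorsionCore
      (stub_CMIsotypicCoreOf (by exact hCM) (stub_CMTorsionCoreOf hFal (by exact hCM))))
    hFree

end Summit.ABC.ABC.Theorems.IsotypicMinkowski

end
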